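import Literature.NumberTheory.Automorphic.AnisotropicUnitaryGroupCompactOfPlace
import Literature.NumberTheory.Automorphic.UnitaryGroupOfFormAdelicTopology
import Literature.NumberTheory.Automorphic.UnitaryGroupLocalFactors
import HarnessLib

/-!
# `U(K)` is compact for an anisotropic hermitian matrix `K` over the LOCAL RING `E_v = ∏_{w ∣ v} E_w` at a non-split place
# (transport of ★ `isCompact_unitaryGroupOfForm_of_anisotropic` along `E_v ≃+* E_w`), and «isotropic binary hermitian ⇒ `−det` is a norm»

Topic `NumberTheory/Automorphic`; namespace `Literature.NumberTheory.Automorphic.UnitaryGroup`.  THEOREMS ONLY (no definition, no instance, no notation,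
no named fact, no `sorry`).  Cell `pub/hodgecm-mathlib`, programme P3a, road «N6nsGerm» (crux H413): input of the (D2ε′) «compact dock at the second class»
brick (LEAD F0P3a-plan (g9) WORD T8-101; B-p08 (g27)'s `hI′` junction takes an abstract compact `C′`).  Seat A-p17 (g21).

* §1 **`isCompact_unitaryGroupOfForm_conjLocal_of_anisotropic`** — for ANY `K ∈ M_n(E_v)` (a local matrix, not necessarily the localisation of a global
  form) whose pairing `h(x, y) = ᵗ(σx) K y` is anisotropic, `U_σ(K) ≤ GL_n(E_v)` is compact, `σ = c ⊗ 1` (★ `conjLocal`): at a non-split `v` the evaluation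
  `E_v → E_w` is a ring isomorphism intertwining `σ` with `σ_w` (★ `conjLocal_apply_eq_of_smul_eq`), `U_σ(K)` is the image of `U_{σ_w}(K_w)` under the
  continuous map `GL_n(E_w) → GL_n(E_v)`, and `U_{σ_w}(K_w)` is compact by ★ `isCompact_unitaryGroupOfForm_of_anisotropic` (integers compact, uniformiser,
  `σ_w` isometric).
* §2 (field `K` with an involution `σ`) **`exists_neg_det_eq_norm_of_hermForm_eq_zero`** — a non-degenerate-or-not hermitian `2 × 2` matrix `G` with an
  ISOTROPIC vector (`h(v, v) = 0`, `v ≠ 0`) has `−det G = σ(z) z` for some `z` (`p·h(v,v) = N(p x + q y) + det G · N(y)`).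

HONEST SCOPE. Local linear algebra ∕ topology; HC_CM is proved only modulo the printed citations until rung 0 closes; nothing printed is discharged here.

## References
* [PlatonovRapinchuk1994] V. Platonov, A. Rapinchuk, *Algebraic Groups and Number Theory* (1994), §3.1 Thm. 3.1 (anisotropic ⇒ compact), §5.1.
* [Rogawski1990] J. D. Rogawski, *Automorphic Representations of Unitary Groups in Three Variables* (1990), §3.8 Prop. 3.8.1 (d) p. 30, §8.2 p. 116
  (the compact centraliser `U(2)_an × U(1)` of the second class).
* [Jacobowitz1962] R. Jacobowitz, *Hermitian forms over local fields*, Amer. J. Math. 84 (1962), §3 (binary forms: isotropic iff `−det` is a norm).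
-/

set_option autoImplicit false

noncomputable section

open scoped Matrix MatrixGroups
open NumberField IsDedekindDomain Matrix

namespace Literature.NumberTheory.Automorphic

namespace UnitaryGroup

/-! ## §1 Compactness of `U_σ(K)` over `E_v` for an anisotropic local `K` -/

section Transport

variable {F E : Type} [Field F] [NumberField F] [Field E] [NumberField E] [Algebra F E] [Algebra.IsQuadraticExtension F E]
  (c : E ≃ₐ[F] E) (hc : c ≠ 1) (v : HeightOneSpectrum (𝓞 F)) (w : PlacesOver E v) (hw : c • w.1 = w.1)
  {n : Type} [Fintype n] [DecidableEq n]

include hc hw in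
/-- **`U_σ(K) ≤ GL_n(E_v)` IS COMPACT FOR AN ANISOTROPIC LOCAL `K`** (`v` non-split, `σ = c ⊗ 1`): transport of ★ `isCompact_unitaryGroupOfForm_of_anisotropic`
from the field `E_w` along the evaluation isomorphism `E_v = ∏_{w′ ∣ v} E_{w′} ≃+* E_w`. [cite: PlatonovRapinchuk1994, §3.1 Thm. 3.1; §5.1] -/
theorem isCompact_unitaryGroupOfForm_conjLocal_of_anisotropic (K : Matrix n n (LocalRing E v))
    (hanis : ∀ x : n → LocalRing E v, hermForm (conjLocal E c v) K x x = 0 → x = 0) :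
    IsCompact ((unitaryGroupOfForm (conjLocal E c v) K : Subgroup (GL n (LocalRing E v))) : Set (GL n (LocalRing E v))) := by
  haveI : Subsingleton (PlacesOver E v) := PlacesOver.subsingleton_of_smul_eq c hc w hw
  letI : Unique (PlacesOver E v) := uniqueOfSubsingleton w
  -- the evaluation ring isomorphism `π : E_v ≃+* E_w` and its compatibility with `σ`
  let π : LocalRing E v ≃+* w.1.adicCompletion E := RingEquiv.piUnique fun w' : PlacesOver E v => w'.1.adicCompletion E
  have hπ : ∀ y : LocalRing E v, π y = y w := fun _ => rfl
  set σw := galAdicCompletionMap (L := E) c hw with hσw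
  have hσπ : ∀ y : LocalRing E v, π (conjLocal E c v y) = σw (π y) := fun y => by
    rw [hπ, hπ, hσw]
    exact conjLocal_apply_eq_of_smul_eq c hc v w hw y
  have hπc : Continuous π := continuous_apply w
  have hπsc : Continuous π.symm := by
    have h := (Homeomorph.piUnique fun w' : PlacesOver E v => w'.1.adicCompletion E).symm.continuous
    exact h
  -- the local matrix read at `w` is anisotropic
  set Kw : Matrix n n (w.1.adicCompletion E) := K.map π with hKw
  have hform : ∀ y : n → LocalRing E v, π (hermForm (conjLocal E c v) K y y) = hermForm σw Kw (π ∘ y) (π ∘ y) := by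
    intro y
    simp only [hermForm, dotProduct, mulVec, Function.comp_apply, map_sum, map_mul, hσπ, hKw, Matrix.map_apply]
  have hanisw : ∀ x : n → w.1.adicCompletion E, hermForm σw Kw x x = 0 → x = 0 := by
    intro x hx
    have hy : hermForm (conjLocal E c v) K (π.symm ∘ x) (π.symm ∘ x) = 0 := by
      apply π.injective
      rw [hform, map_zero]
      have hcomp : (π ∘ (π.symm ∘ x)) = x := funext fun i => π.apply_symm_apply (x i)
      rw [hcomp, hx]
    have h0 := hanis _ hy
    funext i
    have hi := congrFun h0 i
    simp only [Function.comp_apply, Pi.zero_apply] at hi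
    rw [← π.apply_symm_apply (x i), hi, map_zero, Pi.zero_apply]
  -- compactness over the field `E_w`
  haveI := compactSpace_integer_adicCompletion E w.1
  obtain ⟨ϖ, hϖ⟩ := exists_v_eq_exp_neg_one_adicCompletion (E := E) w.1
  have hcw : IsCompact ((unitaryGroupOfForm σw Kw : Subgroup (GL n (w.1.adicCompletion E))) : Set (GL n (w.1.adicCompletion E))) :=
    HermitianLattice.isCompact_unitaryGroupOfForm_of_anisotropic hϖ (fun x => by rw [hσw]; exact valued_galAdicCompletionMap (L := E) c hw x) hanisw
  -- transport back along `ψ := GL_n(π⁻¹)`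
  let ψ : GL n (w.1.adicCompletion E) →* GL n (LocalRing E v) := Units.map (RingHom.mapMatrix π.symm.toRingHom).toMonoidHom
  have hψc : Continuous ψ := Continuous.units_map _ (continuous_id.matrix_map hπsc)
  have hsub : ((unitaryGroupOfForm (conjLocal E c v) K : Subgroup (GL n (LocalRing E v))) : Set (GL n (LocalRing E v))) ⊆
      ψ '' ((unitaryGroupOfForm σw Kw : Subgroup (GL n (w.1.adicCompletion E))) : Set _) := by
    intro g hg
    let φg : GL n (w.1.adicCompletion E) := Units.map (RingHom.mapMatrix π.toRingHom).toMonoidHom g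
    refine ⟨φg, ?_, ?_⟩
    · -- `φ g ∈ U_{σ_w}(K_w)`: apply `π` entrywise to `ᵗ(σg) K g = K`
      have hg' := mem_unitaryGroupOfForm_iff.mp hg
      rw [SetLike.mem_coe, mem_unitaryGroupOfForm_iff]
      have hval : (φg : Matrix n n (w.1.adicCompletion E)) = (g : Matrix n n (LocalRing E v)).map π := rfl
      have hmapσ : ((g : Matrix n n (LocalRing E v)).map π).map σw = ((g : Matrix n n (LocalRing E v)).map (conjLocal E c v)).map π := by
        rw [Matrix.map_map, Matrix.map_map]
        exact Matrix.ext fun i j => (hσπ _).symm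
      have h := congrArg (fun M : Matrix n n (LocalRing E v) => M.map (π : LocalRing E v →+* w.1.adicCompletion E)) hg'
      simp only [Matrix.map_mul, Matrix.transpose_map] at h
      rw [hval, hmapσ, hKw]
      exact h
    · -- `ψ (φ g) = g`
      refine Units.ext (Matrix.ext fun i j => ?_)
      show π.symm (π ((g : Matrix n n (LocalRing E v)) i j)) = (g : Matrix n n (LocalRing E v)) i j
      exact π.symm_apply_apply _
  exact (hcw.image hψc).of_isClosed_subset (isClosed_unitaryGroupOfForm (continuous_conjLocal E c v) K) hsub

end Transport

/-! ## §2 An isotropic binary hermitian matrix has `−det` a norm -/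

section Binary

variable {S : Type*} [CommRing S] (σ : S →+* S)

/-- **ISOTROPIC BINARY HERMITIAN ⇒ `−det` IS A NORM** (commutative ring in which every non-zero element is a unit and `σ(s) s = 0 ⇒ s = 0` — e.g. the local
FIELD `E_v` at a non-split place): if `G ∈ M₂(S)` has `σ(G₀₀) = G₀₀`, `G₁₀ = σ(G₀₁)` and `h(v, v) = ᵗ(σv) G v = 0` for some `v ≠ 0`, then `−det G = σ(z)·z` for some `z`
(`G₀₀·h(v,v) = N(G₀₀v₀ + G₀₁v₁) + det G·N(v₁)`; if `G₀₀ = 0`, `−det G = N(G₀₁)`). [cite: Jacobowitz1962, §3] [cite: Rogawski1990, §3.8 Prop. 3.8.1 (d) p. 30] -/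
theorem exists_neg_det_eq_norm_of_hermForm_eq_zero (hunit : ∀ s : S, s ≠ 0 → IsUnit s) (hN : ∀ s : S, σ s * s = 0 → s = 0)
    {G : Matrix (Fin 2) (Fin 2) S} (h00 : σ (G 0 0) = G 0 0) (h10 : G 1 0 = σ (G 0 1))
    {v : Fin 2 → S} (hv : v ≠ 0) (hiso : hermForm σ G v v = 0) :
    ∃ z : S, -G.det = σ z * z := by
  have hform : hermForm σ G v v = σ (v 0) * (G 0 0 * v 0 + G 0 1 * v 1) + σ (v 1) * (G 1 0 * v 0 + G 1 1 * v 1) := by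
    simp [hermForm, dotProduct, mulVec, Fin.sum_univ_two]
  rw [hform, h10] at hiso
  rw [Matrix.det_fin_two, h10]
  by_cases hp : G 0 0 = 0
  · refine ⟨G 0 1, ?_⟩
    rw [hp]; ring
  · have key : G 0 0 * (σ (v 0) * (G 0 0 * v 0 + G 0 1 * v 1) + σ (v 1) * (σ (G 0 1) * v 0 + G 1 1 * v 1)) =
        σ (G 0 0 * v 0 + G 0 1 * v 1) * (G 0 0 * v 0 + G 0 1 * v 1) + (G 0 0 * G 1 1 - G 0 1 * σ (G 0 1)) * (σ (v 1) * v 1) := by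
      rw [map_add, map_mul, map_mul, h00]; ring
    rw [hiso, mul_zero] at key
    -- `v₁ ≠ 0`: otherwise `N(G₀₀ v₀) = 0`, `v₀ = 0`
    have hv1 : v 1 ≠ 0 := by
      intro h1
      rw [h1, mul_zero, add_zero, map_zero, zero_mul, mul_zero, add_zero] at key
      have h2 : G 0 0 * v 0 = 0 := hN _ key.symm
      have h3 : v 0 = 0 := ((hunit _ hp).mul_right_eq_zero).1 h2
      exact hv (funext fun i => by fin_cases i <;> assumption)
    obtain ⟨w1, hw1⟩ := (hunit _ hv1).exists_right_inv
    have hσw1 : σ (v 1) * σ w1 = 1 := by rw [← map_mul, hw1, map_one]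
    refine ⟨(G 0 0 * v 0 + G 0 1 * v 1) * w1, ?_⟩
    rw [map_mul]
    linear_combination (σ w1 * w1) * key + ((G 0 0 * G 1 1 - G 0 1 * σ (G 0 1)) * (v 1 * w1)) * hσw1 +
      (G 0 0 * G 1 1 - G 0 1 * σ (G 0 1)) * hw1

end Binary

end UnitaryGroup

end Literature.NumberTheory.Automorphic
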